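import Summits.Parity.GeneralizedHardyLittlewood.Theorems.GreenTaoLevelTwoGITwoCyclicInverseBohrAveraging
import Summits.Parity.GeneralizedHardyLittlewood.Theorems.GreenTaoLevelTwoGITwoCyclicInverseBohrRegularPrelims
import Mathlib.Analysis.SpecialFunctions.Complex.CircleAddChar
import Literature.NumberTheory.Sieve.LinearEquationsInPrimesFourierU2

/-!
# Route `GreenTaoLevelTwo`, crux `GITwo` (stmt-Parity-21275), line `birth`, stub `stub_cyclicInverse`:
# descending the derivative correlation to a smaller Bohr set (GT08a §9 Step 3, first display)

Forty-seventh helper file toward the XL stub `stub_cyclicInverse` (B. Green, T. Tao, *An inverse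
theorem for the Gowers `U³(G)` norm*, arXiv:math/0503014, Thm. 68 = PEMS 51 (2008) Thm. 12.8).
Block C13, §9 Step 3 opens by localising the `h`-average of the correlation (gabor)/(eq9.72)
from the regular Bohr set `B₁ = B(S,ρ₁)` to a much smaller set `A` of shifts (there `B₄`):
"by Lemma (avg) (ii) … hence by the pigeonhole principle there exists `h'` … we can absorb all the
`h'` terms".  In sum form, with `I(h) = Σ_x b₂(x+h) b₃(x) e(−μ(h)x)`:
from `κ N #B₁ ≤ Σ_{h∈B₁} |I(h)|`, `A` nonempty with `‖aξ‖ ≤ ερ₁` (`ξ ∈ S`), `200 d ε ≤ κ/2`,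
`ε ≤ 1/(100d)`, and `μ(a + h') = μ(a) + μ(h')` for `a ∈ A`, `h' ∈ B₁`, we get `h' ∈ B₁` with
`(κ/2) N #A ≤ Σ_{a∈A} |Σ_x b₂(x+h'+a) (b₃(x) e(−μ(h')x)) e(−μ(a)x)|` — the same shape on `A`.

* `exists_descent` — the statement above (arXiv Lemma 21 (iii) `exists_shift_avg_ge_of_regular`
  applied to `h ↦ |I(h)|/N`).

References: [GreenTao2008U3Inverse] arXiv:math/0503014, §9 Step 3 (first two displays).
-/

noncomputable section

namespace Summit.Parity.GeneralizedHardyLittlewood.GreenTaoLevelTwoGITwoCyclicInverse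

open Finset ZMod

open Literature.NumberTheory.Sieve

variable {N : ℕ} [NeZero N]

/-- **Descent of the derivative correlation to a small set of shifts (GT08a §9 Step 3).**
See the module docstring. [cite: GreenTao2008U3Inverse, §9 Step 3] -/
theorem exists_descent (S : Finset (ZMod N)) (hS : S.Nonempty) {ρ₁ ε κ : ℝ} (hρ₁ : 0 < ρ₁)
    (hε0 : 0 < ε) (hε100 : ε ≤ 1 / (100 * (#S : ℝ))) (hκε : 200 * (#S : ℝ) * ε ≤ κ / 2)
    (hreg : ∀ r : ℝ, |r| ≤ 1 / (100 * (#S : ℝ)) →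
      (1 - 100 * (#S : ℝ) * |r|) * #{x : ZMod N | ∀ ξ ∈ S, ‖ZMod.toAddCircle (x * ξ)‖ < ρ₁} ≤
          #{x : ZMod N | ∀ ξ ∈ S, ‖ZMod.toAddCircle (x * ξ)‖ < (1 + r) * ρ₁} ∧
        (#{x : ZMod N | ∀ ξ ∈ S, ‖ZMod.toAddCircle (x * ξ)‖ < (1 + r) * ρ₁} : ℝ) ≤
          (1 + 100 * (#S : ℝ) * |r|) * #{x : ZMod N | ∀ ξ ∈ S, ‖ZMod.toAddCircle (x * ξ)‖ < ρ₁})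
    {A : Finset (ZMod N)} (hA : ∀ a ∈ A, ∀ ξ ∈ S, ‖ZMod.toAddCircle (a * ξ)‖ ≤ ε * ρ₁)
    {μ : ZMod N → ZMod N}
    (hadd : ∀ a ∈ A, ∀ h' ∈ ({x : ZMod N | ∀ ξ ∈ S, ‖ZMod.toAddCircle (x * ξ)‖ < ρ₁} :
      Finset (ZMod N)), μ (a + h') = μ a + μ h')
    (b₂ b₃ : ZMod N → ℂ) (hb₂ : ∀ x, ‖b₂ x‖ ≤ 1) (hb₃ : ∀ x, ‖b₃ x‖ ≤ 1)
    (hbig : κ * N * #{x : ZMod N | ∀ ξ ∈ S, ‖ZMod.toAddCircle (x * ξ)‖ < ρ₁} ≤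
      ∑ h ∈ ({x : ZMod N | ∀ ξ ∈ S, ‖ZMod.toAddCircle (x * ξ)‖ < ρ₁} : Finset (ZMod N)),
        ‖∑ x : ZMod N, b₂ (x + h) * b₃ x * stdAddChar (-(μ h * x))‖) :
    ∃ h' ∈ ({x : ZMod N | ∀ ξ ∈ S, ‖ZMod.toAddCircle (x * ξ)‖ < ρ₁} : Finset (ZMod N)),
      κ / 2 * N * #A ≤ ∑ a ∈ A, ‖∑ x : ZMod N,
        b₂ (x + h' + a) * (b₃ x * stdAddChar (-(μ h' * x))) * stdAddChar (-(μ a * x))‖ := by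
  classical
  set B₁ : Finset (ZMod N) := {x : ZMod N | ∀ ξ ∈ S, ‖ZMod.toAddCircle (x * ξ)‖ < ρ₁} with hB₁def
  have hB₁ : ∀ x, x ∈ B₁ ↔ ∀ ξ ∈ S, ‖ZMod.toAddCircle (x * ξ)‖ < ρ₁ := fun x => by
    rw [hB₁def, mem_filter]; simp
  have hNpos : (0 : ℝ) < N := by exact_mod_cast Nat.pos_of_ne_zero (NeZero.ne N)
  have hc1 : (1 : ℝ) ≤ #B₁ := by exact_mod_cast one_le_card_bohr S hρ₁
  have hc0 : (0 : ℝ) < #B₁ := by linarith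
  have hB₁ne : B₁.Nonempty := by
    rw [← card_pos]; have : (0 : ℝ) < #B₁ := hc0
    exact_mod_cast this
  -- regularity at `κ = ±ε`
  set Bp : Finset (ZMod N) := {x : ZMod N | ∀ ξ ∈ S, ‖ZMod.toAddCircle (x * ξ)‖ < (1 + ε) * ρ₁}
    with hBpdef
  set Bm : Finset (ZMod N) := {x : ZMod N | ∀ ξ ∈ S, ‖ZMod.toAddCircle (x * ξ)‖ < (1 - ε) * ρ₁}
    with hBmdef
  have hBp : ∀ x, x ∈ Bp ↔ ∀ ξ ∈ S, ‖ZMod.toAddCircle (x * ξ)‖ < (1 + ε) * ρ₁ := fun x => by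
    rw [hBpdef, mem_filter]; simp
  have hBm : ∀ x, x ∈ Bm ↔ ∀ ξ ∈ S, ‖ZMod.toAddCircle (x * ξ)‖ < (1 - ε) * ρ₁ := fun x => by
    rw [hBmdef, mem_filter]; simp
  have hregp : (#Bp : ℝ) ≤ (1 + 100 * (#S : ℝ) * ε) * #B₁ := by
    have h := (hreg ε (by rw [abs_of_pos hε0]; exact hε100)).2
    rw [abs_of_pos hε0] at h; exact h
  have hregm : (1 - 100 * (#S : ℝ) * ε) * #B₁ ≤ (#Bm : ℝ) := by
    have h := (hreg (-ε) (by rw [abs_neg, abs_of_pos hε0]; exact hε100)).1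
    rw [abs_neg, abs_of_pos hε0, ← sub_eq_add_neg] at h; exact h
  -- the real function `F(h) = ‖I(h)‖/N ∈ [0,1]`
  set I : ZMod N → ℂ := fun h => ∑ x : ZMod N, b₂ (x + h) * b₃ x * stdAddChar (-(μ h * x)) with hI
  have hIle : ∀ h, ‖I h‖ ≤ N := fun h => by
    rw [hI]; simp only
    refine (norm_sum_le _ _).trans ?_
    calc ∑ x : ZMod N, ‖b₂ (x + h) * b₃ x * stdAddChar (-(μ h * x))‖ ≤ ∑ _x : ZMod N, (1 : ℝ) :=
          sum_le_sum fun x _ => by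
            rw [norm_mul, norm_mul, norm_stdAddChar, mul_one]
            calc ‖b₂ (x + h)‖ * ‖b₃ x‖ ≤ 1 * 1 :=
                  mul_le_mul (hb₂ _) (hb₃ _) (norm_nonneg _) zero_le_one
              _ = 1 := one_mul _
      _ = N := by rw [sum_const, card_univ, ZMod.card, nsmul_eq_mul, mul_one]
  set F : ZMod N → ℝ := fun h => ‖I h‖ / N with hF
  have hFabs : ∀ h, |F h| ≤ 1 := fun h => by
    rw [hF]; simp only
    rw [abs_of_nonneg (by positivity), div_le_one hNpos]; exact hIle h
  -- arXiv Lemma 21 (iii)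
  obtain ⟨h', hh', havg⟩ :=
    exists_shift_avg_ge_of_regular hB₁ hBp hBm hS hA hregp hregm hB₁ne hFabs
  refine ⟨h', hh', ?_⟩
  -- `Σ_{h∈B₁} F h ≥ κ #B₁`
  have hsumF : κ * #B₁ ≤ ∑ h ∈ B₁, F h := by
    rw [hF]; simp only
    rw [← sum_div, le_div_iff₀ hNpos]
    calc κ * #B₁ * N = κ * N * #B₁ := by ring
      _ ≤ _ := hbig
  -- hence `Σ_{a∈A} F(h' + a) ≥ (κ/2) #A`
  have hsumA : κ / 2 * #A ≤ ∑ a ∈ A, F (h' + a) := by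
    have h1 : (#A : ℝ) * (κ * #B₁) ≤ #A * ∑ h ∈ B₁, F h :=
      mul_le_mul_of_nonneg_left hsumF (Nat.cast_nonneg _)
    have h2 := mul_le_mul_of_nonneg_right hκε
      (mul_nonneg (Nat.cast_nonneg _) (Nat.cast_nonneg _) : (0 : ℝ) ≤ #A * #B₁)
    refine le_of_mul_le_mul_left ?_ hc0
    -- `#B₁ · (κ/2 #A) ≤ #B₁ · Σ_{a∈A} F(h'+a)`
    linarith [havg]
  -- unfold `F` and rewrite `I(h' + a)`
  rw [hF] at hsumA
  simp only at hsumA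
  rw [← sum_div, le_div_iff₀ hNpos] at hsumA
  have hIa : ∀ a ∈ A, I (h' + a) = ∑ x : ZMod N,
      b₂ (x + h' + a) * (b₃ x * stdAddChar (-(μ h' * x))) * stdAddChar (-(μ a * x)) := by
    intro a ha
    rw [hI]; simp only
    refine sum_congr rfl fun x _ => ?_
    have hμ : μ (h' + a) = μ a + μ h' := by rw [add_comm]; exact hadd a ha h' hh'
    rw [hμ]
    have : (stdAddChar (-((μ a + μ h') * x)) : ℂ) = stdAddChar (-(μ h' * x)) * stdAddChar (-(μ a * x)) := by
      rw [← AddChar.map_add_eq_mul]; congr 1; ring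
    rw [this, show x + (h' + a) = x + h' + a by ring]; ring
  calc κ / 2 * N * #A = κ / 2 * #A * N := by ring
    _ ≤ ∑ a ∈ A, ‖I (h' + a)‖ := hsumA
    _ = _ := sum_congr rfl fun a ha => by rw [hIa a ha]

end Summit.Parity.GeneralizedHardyLittlewood.GreenTaoLevelTwoGITwoCyclicInverse
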